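import Summits.ResolutionOfSingularities.ResolutionOfSingularities.Theorems.PurelyInseparableDim4ResConeAlternation
import HarnessLib
import HarnessLib.Audit.Tags

/-!
# Purely inseparable four-folds — AT A SATELLITE THE TWO STEP DIRECTIONS SPAN A PLANE OF THE POLAR KERNEL ON WHICH EVERY KEPT LETTER
# VANISHES, any `e_G`; for POWER CONES (`e_G = 3`) two kept letters are dependent on the kernel (cell `res-dim4-pi`, K2(p) lane, B rows)

[OURS · counted 0 · cell `res-dim4-pi` · K2(p) lane holder res-dim4-p-12 g5 (rung-0 exit table rows B1–B4 «no tool»; text l.6030, res-dim4-p-3 g5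
«worth typing» l.6039); seat res-dim4-p-9 g5 over (I2) `chain_resVertex_step_inf_hyperplane_eq` and `chain_direction_mem_resVertex`; the
`e_G = 2` span form is res-dim4-p-1 g6's `…SatelliteKernelSpan`, the `e_G = 2` kill res-dim4-p-9 g5's `…PermanentConeLetter`.]  Nothing here
proves any TAIL(p, d, e), K2(p), K2(7) or resolution of singularities in dimension ≥ 4 / characteristic `p` — NOT proved.  AI kernel work,
weaker than expert review.

(S) On a constant-`(d, e_G = e)` tail let `(k, k+1)` be a SATELLITE pair (`j (k+1) ≠ j k`, `b (k+1) (j k) = 0`).  Then `dir_k := direction (j k) (b k)`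
and `dir_{k+1}` BOTH lie in `V_k := resVertex (c k)` (the second by (I2): `dir_{k+1} ∈ V_{k+1} ⊓ H_{j k} = V_k ⊓ H_{j k}`), they are linearly
independent (`(j k)`-coordinates `1` / `0`), and every letter `z` KEPT at `k` and `k + 1` (`z ∉ {j k, j (k+1)}`, `b k z = b (k+1) z = 0`) vanishes
on both.  So the coordinate functionals of the kept letters have joint rank `≤ e − 2` on `V_k`:
* §1 `direction_succ_mem_resVertex_of_satellite`, `linearIndependent_directions_of_satellite`, **`exists_keptPlane_of_satellite`** (any `e`);
* §2 **`kept_pair_dependent_of_satellite`** (`e_G = 3`, POWER CONE `g = a·ℓ^d`, `V = ker ℓ`): for two letters `z ≠ z′` kept through the pair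
  there are `(α, β) ≠ (0, 0)` with `α·v_z + β·v_{z′} = 0` for all `v ∈ V_k` — in the cone's terms `ℓ_k ∈ span(x_z, x_{z′})`: at every
  pre-satellite time the power cone is a `d`-th power of a linear form IN THE TWO KEPT LETTERS ONLY (res-dim4-p-3 g5's
  `powerCone_corner_frozen` p712052 without translation-freeness, at pre-satellite times).
(`e_G = 2`: both kept letters are cone letters — res-dim4-p-1 g6 / `not_isSatellite_of_transversal_kept`.)  NOT here: any kill of a B row.
[cite: CossartJannsenSaito2020, Thm. 3.10 (4), Thm. 3.14, Thm. 9.3]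
bears_on: LADDER-RESOLUTION:D157-DOOR2 (res-dim4-pi · K2(p) B rows · satellite directions, any e_G).  Supports stmt-ResolutionOfSingularities-16155
(helper).
-/

set_option linter.dupNamespace false -- mandated namespace of this single-conjunct summit

noncomputable section

namespace Summit.ResolutionOfSingularities.ResolutionOfSingularities.Theorems.PIDim4

namespace ResCone

open MvPolynomial Finset
open Literature.AlgebraicGeometry.Resolution
open Literature.AlgebraicGeometry.Resolution.CentreBlowup
open Literature.AlgebraicGeometry.Resolution.Hauser2010
open Literature.AlgebraicGeometry.Resolution.HauserPerlega2019
open PointBlowup (additiveSubspace direction)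

variable {K : Type} [Field K] {p : ℕ} [Fact p.Prime] [DecidableEq K]

/-! ## 1. The kept plane at a satellite, any `e_G` -/

/-- **At a satellite the NEXT step direction lies in the CURRENT polar kernel** (any constant `e_G`): `dir_{k+1} ∈ V_{k+1} ⊓ H_{j k} = V_k ⊓ H_{j k}`
by (I2). [OURS] [cite: CossartJannsenSaito2020, Thm. 3.10 (4), Thm. 9.3] -/
theorem direction_succ_mem_resVertex_of_satellite {c : ℕ → State K} {j : ℕ → Fin 4} {b : ℕ → Fin 4 → K}
    (hc : ∀ k, IsIsolated p (c k).F ∧ Step0 p (c k) (c (k + 1))) (hw : FreeTail.IsWitnessedChain p c j b)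
    (hr0 : ∀ e ∈ (c 0).F.support, (c 0).r ≤ e) (hfloor : ∀ k, ordZero (c k).F ≠ p) {k₀ : ℕ} {d : ℕ∞}
    (hshade : ∀ k, k₀ ≤ k → (c k).shade = d) {e : ℕ} (he : ∀ k, k₀ ≤ k → Module.finrank K (resVertex (c k)) = e)
    {k : ℕ} (hk : k₀ ≤ k) (hsat : FreeTail.IsSatellite j b k) :
    direction (j (k + 1)) (b (k + 1)) ∈ resVertex (c k) := by
  have hdir₁ : direction (j (k + 1)) (b (k + 1)) ∈ resVertex (c (k + 1)) :=
    chain_direction_mem_resVertex p hc hw hr0 hfloor hshade (show k₀ ≤ k + 1 by omega)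
  have hj : direction (j (k + 1)) (b (k + 1)) (j k) = 0 := by rw [direction_apply_of_ne (Ne.symm hsat.1), hsat.2]
  have h : direction (j (k + 1)) (b (k + 1)) ∈ resVertex (c (k + 1)) ⊓ hyperplane (j k) :=
    Submodule.mem_inf.mpr ⟨hdir₁, mem_hyperplane.mpr hj⟩
  rw [chain_resVertex_step_inf_hyperplane_eq p hc hw hr0 hfloor hshade he hk] at h
  exact (Submodule.mem_inf.mp h).1

omit [Fact p.Prime] [DecidableEq K] in
/-- **The two step directions of a satellite pair are linearly independent** (`(j k)`-coordinates `1` and `0`). [folklore] -/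
theorem linearIndependent_directions_of_satellite {j : ℕ → Fin 4} {b : ℕ → Fin 4 → K} {k : ℕ} (hsat : FreeTail.IsSatellite j b k) :
    LinearIndependent K ![direction (j k) (b k), direction (j (k + 1)) (b (k + 1))] := by
  refine LinearIndependent.pair_iff.mpr fun s t hst => ?_
  have hj : direction (j (k + 1)) (b (k + 1)) (j k) = 0 := by rw [direction_apply_of_ne (Ne.symm hsat.1), hsat.2]
  have h1 := congrFun hst (j k)
  simp only [Pi.add_apply, Pi.smul_apply, smul_eq_mul, direction_apply_self, mul_one, hj, mul_zero, add_zero, Pi.zero_apply] at h1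
  have h2 := congrFun hst (j (k + 1))
  simp only [Pi.add_apply, Pi.smul_apply, smul_eq_mul, h1, zero_mul, zero_add, direction_apply_self, mul_one, Pi.zero_apply] at h2
  exact ⟨h1, h2⟩

/-- **THE KEPT PLANE AT A SATELLITE, any `e_G`** (S).  On a constant-`(d, e)` tail with a satellite pair `(k, k+1)` there is a PLANE `W ≤ resVertex (c k)`
(`finrank W = 2`, spanned by the two step directions) on which the coordinate of EVERY letter kept at `k` and `k + 1` vanishes — so the kept
letters' coordinate functionals have joint rank `≤ e − 2` on the kernel. [OURS] [cite: CossartJannsenSaito2020, Thm. 3.10 (4), Thm. 9.3] -/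
theorem exists_keptPlane_of_satellite {c : ℕ → State K} {j : ℕ → Fin 4} {b : ℕ → Fin 4 → K}
    (hc : ∀ k, IsIsolated p (c k).F ∧ Step0 p (c k) (c (k + 1))) (hw : FreeTail.IsWitnessedChain p c j b)
    (hr0 : ∀ e ∈ (c 0).F.support, (c 0).r ≤ e) (hfloor : ∀ k, ordZero (c k).F ≠ p) {k₀ : ℕ} {d : ℕ∞}
    (hshade : ∀ k, k₀ ≤ k → (c k).shade = d) {e : ℕ} (he : ∀ k, k₀ ≤ k → Module.finrank K (resVertex (c k)) = e)
    {k : ℕ} (hk : k₀ ≤ k) (hsat : FreeTail.IsSatellite j b k) :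
    ∃ W : Submodule K (Fin 4 → K), W ≤ resVertex (c k) ∧ Module.finrank K W = 2 ∧
      ∀ z, z ≠ j k → z ≠ j (k + 1) → b k z = 0 → b (k + 1) z = 0 → ∀ v ∈ W, v z = 0 := by
  set f : Fin 2 → (Fin 4 → K) := ![direction (j k) (b k), direction (j (k + 1)) (b (k + 1))] with hf
  refine ⟨Submodule.span K (Set.range f), ?_, ?_, ?_⟩
  · rw [Submodule.span_le, Set.range_subset_iff]
    intro i
    fin_cases i
    · exact chain_direction_mem_resVertex p hc hw hr0 hfloor hshade hk
    · exact direction_succ_mem_resVertex_of_satellite hc hw hr0 hfloor hshade he hk hsat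
  · rw [finrank_span_eq_card (linearIndependent_directions_of_satellite hsat), Fintype.card_fin]
  · intro z hzj hzj' hbz hbz' v hv
    rw [Submodule.mem_span_range_iff_exists_fun] at hv
    obtain ⟨cf, rfl⟩ := hv
    simp only [Fin.sum_univ_two, Pi.add_apply, Pi.smul_apply, smul_eq_mul, hf, Matrix.cons_val_zero, Matrix.cons_val_one]
    rw [direction_apply_of_ne hzj, direction_apply_of_ne hzj', hbz, hbz', mul_zero, mul_zero, add_zero]

/-! ## 2. Power cones: two kept letters are dependent on the kernel -/

/-- **POWER CONES: TWO LETTERS KEPT THROUGH A SATELLITE ARE DEPENDENT ON THE KERNEL** (`e_G = 3`).  On a constant-`(d, 3)` tail with a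
satellite pair `(k, k+1)` and letters `z ≠ z′` kept at `k` and `k + 1`, there are `(α, β) ≠ (0, 0)` with `α·v_z + β·v_{z′} = 0` for every
`v ∈ resVertex (c k)`.  (For the power cone `g_k = a·ℓ_k^d`, `resVertex = ker ℓ_k`, this says `ℓ_k ∈ span(x_z, x_{z′})`: the cone is a `d`-th power
of a form in the two kept letters.)  Proof: otherwise two kernel vectors `u, v` with independent `(z, z′)`-rows together with the two step
directions (which have zero `(z, z′)`-rows, §1) are four independent vectors in a `3`-dimensional kernel. [OURS]
[cite: CossartJannsenSaito2020, Thm. 3.10 (4), Thm. 3.14, Thm. 9.3] -/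
theorem kept_pair_dependent_of_satellite {c : ℕ → State K} {j : ℕ → Fin 4} {b : ℕ → Fin 4 → K}
    (hc : ∀ k, IsIsolated p (c k).F ∧ Step0 p (c k) (c (k + 1))) (hw : FreeTail.IsWitnessedChain p c j b)
    (hr0 : ∀ e ∈ (c 0).F.support, (c 0).r ≤ e) (hfloor : ∀ k, ordZero (c k).F ≠ p) {k₀ : ℕ} {d : ℕ∞}
    (hshade : ∀ k, k₀ ≤ k → (c k).shade = d) (he : ∀ k, k₀ ≤ k → Module.finrank K (resVertex (c k)) = 3)
    {k : ℕ} (hk : k₀ ≤ k) (hsat : FreeTail.IsSatellite j b k) {z z' : Fin 4}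
    (hzj : z ≠ j k) (hzj' : z ≠ j (k + 1)) (hbz : b k z = 0) (hbz' : b (k + 1) z = 0)
    (hz'j : z' ≠ j k) (hz'j' : z' ≠ j (k + 1)) (hbz₂ : b k z' = 0) (hbz₂' : b (k + 1) z' = 0) :
    ∃ α β : K, (α ≠ 0 ∨ β ≠ 0) ∧ ∀ v ∈ resVertex (c k), α * v z + β * v z' = 0 := by
  classical
  have hd₀ : direction (j k) (b k) ∈ resVertex (c k) := chain_direction_mem_resVertex p hc hw hr0 hfloor hshade hk
  have hd₁ : direction (j (k + 1)) (b (k + 1)) ∈ resVertex (c k) :=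
    direction_succ_mem_resVertex_of_satellite hc hw hr0 hfloor hshade he hk hsat
  have hd₀z : direction (j k) (b k) z = 0 := by rw [direction_apply_of_ne hzj, hbz]
  have hd₀z' : direction (j k) (b k) z' = 0 := by rw [direction_apply_of_ne hz'j, hbz₂]
  have hd₁z : direction (j (k + 1)) (b (k + 1)) z = 0 := by rw [direction_apply_of_ne hzj', hbz']
  have hd₁z' : direction (j (k + 1)) (b (k + 1)) z' = 0 := by rw [direction_apply_of_ne hz'j', hbz₂']
  have hd₁j : direction (j (k + 1)) (b (k + 1)) (j k) = 0 := by rw [direction_apply_of_ne (Ne.symm hsat.1), hsat.2]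
  -- either every kernel vector has zero `(z, z′)`-row (then `(1, 0)` works) …
  by_cases hall : ∀ u ∈ resVertex (c k), u z = 0 ∧ u z' = 0
  · exact ⟨1, 0, Or.inl one_ne_zero, fun v hv => by rw [(hall v hv).1, (hall v hv).2, mul_zero, mul_zero, add_zero]⟩
  -- … or some `u` has a non-zero row; take `(α, β) := (u z′, −u z)`
  push Not at hall
  obtain ⟨u, huV, hu⟩ := hall
  have hu0 : u z' ≠ 0 ∨ -u z ≠ 0 := by
    by_cases huz : u z = 0
    · exact Or.inl (hu huz)
    · exact Or.inr (neg_ne_zero.mpr huz)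
  refine ⟨u z', -u z, hu0, fun v hv => ?_⟩
  -- if the determinant were non-zero, `dir_k, dir_{k+1}, u, v` would be four independent vectors of the 3-dimensional kernel
  by_contra hdet
  have hind : LinearIndependent K ![direction (j k) (b k), direction (j (k + 1)) (b (k + 1)), u, v] := by
    rw [Fintype.linearIndependent_iff]
    intro g hg i
    have hsum : ∀ t, g 0 * direction (j k) (b k) t + g 1 * direction (j (k + 1)) (b (k + 1)) t + g 2 * u t + g 3 * v t = 0 := by
      intro t
      have h := congrFun hg t
      simp only [Finset.sum_apply, Pi.smul_apply, smul_eq_mul, Fin.sum_univ_four, Pi.zero_apply] at h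
      exact h
    have hz₁ := hsum z
    have hz₂ := hsum z'
    rw [hd₀z, hd₁z, mul_zero, mul_zero, zero_add, zero_add] at hz₁
    rw [hd₀z', hd₁z', mul_zero, mul_zero, zero_add, zero_add] at hz₂
    -- Cramer: `(g 2, g 3)` solves a system with non-zero determinant `u z · v z′ − u z′ · v z`
    have hg3 : g 3 = 0 := by
      have h : g 3 * (u z' * v z + -u z * v z') = 0 := by linear_combination u z' * hz₁ - u z * hz₂
      exact (mul_eq_zero.mp h).resolve_right hdet
    have hg2 : g 2 = 0 := by
      rw [hg3, zero_mul, add_zero] at hz₁ hz₂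
      rcases hu0 with h | h
      · exact (mul_eq_zero.mp hz₂).resolve_right h
      · exact (mul_eq_zero.mp hz₁).resolve_right (neg_ne_zero.mp h)
    have hj₁ := hsum (j k)
    rw [direction_apply_self, hd₁j, hg2, hg3, mul_one, mul_zero, zero_mul, zero_mul, add_zero, add_zero, add_zero] at hj₁
    have hj₂ := hsum (j (k + 1))
    rw [hj₁, hg2, hg3, direction_apply_self, zero_mul, mul_one, zero_mul, zero_mul, zero_add, add_zero, add_zero] at hj₂
    fin_cases i
    · exact hj₁
    · exact hj₂
    · exact hg2
    · exact hg3
  have hle : Submodule.span K (Set.range ![direction (j k) (b k), direction (j (k + 1)) (b (k + 1)), u, v]) ≤ resVertex (c k) := by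
    rw [Submodule.span_le, Set.range_subset_iff]
    intro i
    fin_cases i
    · exact hd₀
    · exact hd₁
    · exact huV
    · exact hv
  have h4 := Submodule.finrank_mono hle
  rw [finrank_span_eq_card hind, Fintype.card_fin, he k hk] at h4
  omega

end ResCone

end Summit.ResolutionOfSingularities.ResolutionOfSingularities.Theorems.PIDim4

end
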